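import Summits.BirchSwinnertonDyer.BirchSwinnertonDyer.Theorems.SignedBaseChangeAnticyclotomicEisensteinDivisibilityControlTorsion
import Literature.NumberTheory.EllipticCurves.HeegnerPointsKolyvaginTorsionProofs
import Literature.NumberTheory.EllipticCurves.YanZhu2026.GreenbergMainTheoremsAnyRoot
import HarnessLib

/-!
# `stub_torsionSS` of line `bdpline` (crux `AnticyclotomicEisensteinDivisibility`, stmt-BirchSwinnertonDyer-20727)
# from ONE-variable anticyclotomic inputs: a kernel-checked reshape template

Width seat bsd-line-sbc-p1-w2 gen 2 (2026-08-28). The registered stub `stub_torsionSS` (skeleton bdpline v8,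
sha16 1564f7cd218458e9) asks, under the crux telescope (good supersingular `p ≥ 5`, `Surj`, `K` imaginary
quadratic of Heegner type, `p = v v̄`, `(κ₁, κ₂; γ₁, γ₂)` the cyclotomic/anticyclotomic pair with a generator
pair, …), for `Module.IsTorsion Λ₂ X_Gr(E/K̃_∞)` — a TWO-variable statement with no print at additive
conductor. This file proves it FROM TWO ONE-VARIABLE INPUTS, with the stub's binders copied verbatim
(minus the two leading named-fact antecedents `SignedTwoVariableInputs →` and
`nonempty_modularParametrizationData →`, which the stub never uses):

* (a) `Module.IsTorsion Λ (X_ac)`, `X_ac = Castella2018.AcSelmer.XAc (W.baseChange K) p κ₂ v̄ ∅ γ₂` — the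
  Λ_ac-torsion of the anticyclotomic BDP/Greenberg Selmer dual (strict at `v̄`, relaxed at `v`, trivial away
  from `p`): the PRINTED currency (Castella 2018 Thm. 2.3 / CGLS 2022 Thm. 4.2.2 at ordinary `p`;
  Kobayashi–Ota 2020 at supersingular `p`, acq-07292) and exactly the hypothesis the v8 composition already
  hands to S1 (`stub_bdpLowerHalfExistsSS`);
* (b) the LOCAL DISCREPANCY input: every character of `S = H¹_{nr,v̄}(K̃_∞, E[p^∞])` vanishing on
  `res(Sel_v̄(K_∞⁻, E[p^∞]))` is killed, on `res(res⁻¹ S)`, by some non-zero `g ∈ Λ = ℤ_p⟦T₂⟧` — i.e. the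
  Pontryagin dual of `Q = res⁻¹(S) / Sel_v̄(K_∞⁻, E[p^∞])` (classes over `K_∞⁻` that become Greenberg over
  `K̃_∞`, modulo Castella's) is `Λ`-torsion; a statement about the places of `K_∞⁻` above `v̄` (strict vs.
  potentially unramified; finitely many places, bounded coranks) and away from `p` (trivial vs. potentially
  unramified; `K̃_∞/K_∞⁻` is unramified there).

The proof is `SignedBaseChangeAcDivControlTorsion.xGr₂_isTorsion_of_isTorsion_XAc_of_local` (p613583: finite
generation p610206 + control surjection p561609/p567002 + cokernel half p612958 + rank lemma p553279) with
`E(K)[p] = 0` discharged from `Surj`, `p ≥ 5` and `K` imaginary quadratic exactly as in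
`SignedBaseChangeAcDivControl.stub_controlSurjSS` (`torsionBy_eq_bot_of_isImaginaryQuadratic`, Gross 1991 §2).
INTENDED USE (next lead of `bdpline`): reshape `stub_torsionSS` into `stub_torsionAcSS` := (a) and
`stub_localDiscrepancySS` := (b) under the same telescope and define
`stub_torsionSS := stub_torsionSS_of_isTorsion_XAc_of_local … (stub_torsionAcSS …) (stub_localDiscrepancySS …)`;
under the staged 17-SS restate (a) is the child's natural one-variable hypothesis. Most telescope binders
are idle here (only `Surj`, `5 ≤ p`, `IsImaginaryQuadratic K` and the generator pair are used). Nothing about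
BSD is asserted; (a) and (b) are NOT proved here.

References: C. Skinner, E. Urban, Invent. Math. 195 (2014), Prop. 3.2.8 (p. 23); R. Greenberg, LNM 1716
(1999), §3; F. Castella, Camb. J. Math. 6 (2018), Def. 2.2, Thm. 2.3; B. Gross, in *L-functions and
Arithmetic* (1991), §2.
-/

-- D-0017: single-problem summit, the namespace repeats the problem name by design.
set_option linter.dupNamespace false
set_option autoImplicit false

noncomputable section

open scoped Classical

open Literature.NumberTheory.EllipticCurves Literature.NumberTheory.EllipticCurves.Castella2018

namespace Summit.BirchSwinnertonDyer.BirchSwinnertonDyer.Theorems.SignedBaseChangeAcDivControlTorsion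

/-- **`stub_torsionSS` ⟸ (a) `X_ac` `Λ`-torsion + (b) local discrepancy `Λ`-cotorsion**, with the telescope
binders of the registered stub of line `bdpline` (v8) copied verbatim after the two unused named-fact
antecedents. `E(K)[p] = 0` comes from `Surj`, `p ≠ 2`, `K` imaginary quadratic
(`torsionBy_eq_bot_of_isImaginaryQuadratic`); then
`xGr₂_isTorsion_of_isTorsion_XAc_of_local (W.baseChange K)`. A reshape template; (a), (b) are hypotheses.
[cite: SkinnerUrban2014, Prop. 3.2.8 (p. 23)] [cite: Castella2018, Def. 2.2 and Thm. 2.3 (arXiv:1704.06608 p. 5)]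
[cite: GrossLMS1991, §2 (after (2.2))] -/
theorem stub_torsionSS_of_isTorsion_XAc_of_local :
    ∀ (W : WeierstrassCurve ℚ) [W.IsElliptic] [W.IsGloballyMinimal] (p : ℕ) [Fact p.Prime], 5 ≤ p → W.HasGoodReductionAtPrime p → W.frobeniusTrace p = 0 → Literature.NumberTheory.EllipticCurves.Rank1Residual.Surj W p → ∀ (K : Type) [Field K] [NumberField K] (ι : PadicAlgCl p ≃+* ℂ) (v vbar : IsDedekindDomain.HeightOneSpectrum (NumberField.RingOfIntegers K)) (κ₁ κ₂ : Literature.NumberTheory.EllipticCurves.ZpExtension K p) (γ₁ γ₂ : Field.absoluteGaloisGroup K) [Fact (Literature.NumberTheory.EllipticCurves.ZpExtension.IsTopGeneratorPair κ₁ κ₂ γ₁ γ₂)] [NeZero (NumberField.discr K).natAbs] (N : ℕ) [NeZero N] (f : CuspForm (CongruenceSubgroup.Gamma0 N) 2), Literature.NumberTheory.EllipticCurves.ModularForms.IsNewformOf W f → (N : ℤ) = W.conductorNorm ℤ → Literature.NumberTheory.EllipticCurves.IsImaginaryQuadratic K → ((Ideal.span {(p : ℤ)}).primesOver (NumberField.RingOfIntegers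 K)).ncard = 2 → ((p : ℕ) : NumberField.RingOfIntegers K) ∈ v.asIdeal → ((p : ℕ) : NumberField.RingOfIntegers K) ∈ vbar.asIdeal → vbar ≠ v → (∀ (w : NumberField.InfinitePlace K) (k : NumberField.RingOfIntegers K), k ∈ v.asIdeal ↔ ‖ι.symm (w.embedding (k : K))‖ < 1) → IsCoprime (N : ℤ) (NumberField.discr K) → (∀ ℓ : ℕ, ℓ.Prime → ℓ ∣ N → ((Ideal.span {(ℓ : ℤ)}).primesOver (NumberField.RingOfIntegers K)).ncard = 2) → Odd (NumberField.discr K) → NumberField.discr K ≠ -3 → κ₁.IsCyclotomic → κ₂.IsAnticyclotomic →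
      -- (a) one-variable anticyclotomic torsion (print currency)
      (haveI : Fact (κ₂.IsTopGenerator γ₂) := ⟨Literature.NumberTheory.EllipticCurves.YanZhu2026.isTopGenerator_of_pair (κ₁ := κ₁) (γ₁ := γ₁)⟩; Module.IsTorsion (Literature.NumberTheory.EllipticCurves.IwasawaAlgebra p) (Literature.NumberTheory.EllipticCurves.Castella2018.AcSelmer.XAc (W.baseChange K) p κ₂ vbar ∅ γ₂)) →
      -- (b) the local discrepancy `Q = res⁻¹(H¹_{nr,v̄}(K̃_∞)) / Sel_v̄(K_∞⁻)` is `Λ`-cotorsion (Pontryagin-dual form)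
      (∀ x : (W.baseChange K).XGr₂ p κ₁ κ₂ vbar γ₁ γ₂,
        (∀ s : Literature.NumberTheory.EllipticCurves.Castella2018.AcSelmer.selmerAc (W.baseChange K) p κ₂ vbar ∅,
          x ((W.baseChange K).selmerAcToUnrSelmer₂ p κ₁ κ₂ vbar s) = 0) →
        ∃ g : Literature.NumberTheory.EllipticCurves.IwasawaAlgebra p, g ≠ 0 ∧
          ∀ (a : (W.baseChange K).subgroupH1 p κ₂.kerSubgroup)
            (ha : (W.baseChange K).resOfLe p (Literature.NumberTheory.EllipticCurves.ZpExtension.pairKer_le_right κ₁ κ₂) a ∈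
              Literature.NumberTheory.EllipticCurves.unrSelmer₂ κ₁ κ₂ ((W.baseChange K).geomPrimaryTorsion p) vbar),
            ((PowerSeries.C g : Literature.NumberTheory.EllipticCurves.IwasawaAlgebra₂ p) • x) ⟨_, ha⟩ = 0) →
      Module.IsTorsion (Literature.NumberTheory.EllipticCurves.IwasawaAlgebra₂ p) ((W.baseChange K).XGr₂ p κ₁ κ₂ vbar γ₁ γ₂) := by
  intro W _ _ p _ hp _ _ hs K _ _ ι v vbar κ₁ κ₂ γ₁ γ₂ _ _ N _ f _ _ hK _ _ _ _ _ _ _ _ _ _ _ hac hQ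
  haveI hγ₂ : Fact (κ₂.IsTopGenerator γ₂) :=
    ⟨Literature.NumberTheory.EllipticCurves.YanZhu2026.isTopGenerator_of_pair (κ₁ := κ₁) (γ₁ := γ₁)⟩
  -- `E(K)[p] = 0` from `Surj`, `p ≠ 2`, `K` imaginary quadratic
  have hp2 : p ≠ 2 := by omega
  have htor := torsionBy_eq_bot_of_isImaginaryQuadratic W K hK (Fact.out) hp2 hs
  have hKp : ∀ P : (W.baseChange K).toAffine.Point, p • P = 0 → P = 0 := fun P hP => by
    have hmem : P ∈ AddSubgroup.torsionBy (W.baseChange K).toAffine.Point (p : ℤ) :=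
      AddSubgroup.torsionBy.nsmul_iff.mpr hP
    rw [htor] at hmem
    exact AddSubgroup.mem_bot.mp hmem
  haveI : (W.baseChange K).IsElliptic := by rw [WeierstrassCurve.baseChange]; infer_instance
  exact xGr₂_isTorsion_of_isTorsion_XAc_of_local (W.baseChange K) p κ₁ κ₂ vbar γ₁ γ₂ hKp hac hQ

end Summit.BirchSwinnertonDyer.BirchSwinnertonDyer.Theorems.SignedBaseChangeAcDivControlTorsion

end
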